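import Literature.NumberTheory.Automorphic.ArchRankinSelbergTestVectorRankOne
import Literature.NumberTheory.Automorphic.ArchRankinSelbergOfTorusKirillov
import HarnessLib

/-!
# The factorising polynomial-times-Gaussian test functions of the archimedean `GL₂ × GL₂`
# Rankin–Selberg integral (Humphries–Jo (2024), (5.1), (5.3) and the proof of Prop. 5.2)

Topic `NumberTheory/Automorphic`; namespace `Literature.NumberTheory.Automorphic`. Theorems only (no
definition, no named fact, no instance). The test functions `Φ(x) = P(x) exp(-d_F π x ᵗx̄)` of
Humphries–Jo (2024), Prop. 5.2 — `P` a polynomial, HOMOGENEOUS for the diagonal action of the scalars,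
times the `K_n`-invariant standard Gaussian (5.1) — in the tree's rank-two vocabulary
(`ArchRankinSelbergTestVector`): for every function `P` on `K_∞²` which is a complex polynomial in the real
coordinates and satisfies `P(c · x) = χ(c) P(x)` (`c ∈ K_∞ˣ`), the function
`Φ_∞(z) = P(x) exp(-π Σ_j (Σ_{w real} x_{j,w}² + Σ_{w complex} |x_{j,w}|²))` (`x = ` the image of `z` in
`(K ⊗ ℝ)² = K_∞²`)

* is polynomial-times-Gaussian, `IsArchPolyGaussian 2 K Φ_∞` (`exists_isArchPolyGaussian_factor`, with the
  Gaussian written as `exp(-‖T x‖²)` for an explicit linear isomorphism `T` onto Euclidean space, as in the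
  rank-one `exists_isArchPolyGaussian_tate`), and
* FACTORS along the last row of `diag(y) k`, `k ∈ K_∞`:
  `Φ_∞(e₂ diag(y) k) = χ(y₂) exp(-π Σ_w |y_{2,w}|²) · P(e₂ k)` — the last row of `diag(y) k` is `y₂ · e₂ k`
  (`archLastRow_glDiagonal_mul`), `P` is homogeneous, and the rows of `k ∈ K_∞ = U(2, K_∞)` are unit
  vectors (`sum_sq_lastRow_eq_one_of_mem_Kinf`, `sum_norm_sq_lastRow_eq_one_of_mem_Kinf`), so that the
  Gaussian is `K_∞`-invariant (Humphries–Jo: "`Φ_ur(xk) = Φ_ur(x)` for all `k ∈ K_n`").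

This is the hypothesis `hΦ` of the torus reduction `archRankinSelbergPairIntegralCplx_two_eq_torus`
(`ArchRankinSelbergTorusReductionGL2`), with `g(c) = χ(c) exp(-π Σ_w |c_w|²)` and `P(k) = P(e₂ k)`.

## References

* P. Humphries, Y. Jo, *Test vectors for archimedean period integrals*, Publ. Mat. 68 (2024), §5,
  (5.1), (5.3), Prop. 5.2 [HumphriesJo2024].
* J. Tate, *Fourier analysis in number fields and Hecke's zeta-functions*, in Cassels–Fröhlich (1967),
  Ch. XV, §2.5 [TateThesis1967].
-/

noncomputable section

open MeasureTheory Measure NumberField NumberField.InfinitePlace NumberField.mixedEmbedding IsDedekindDomain Set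
open scoped MatrixGroups ENNReal NNReal Classical ComplexConjugate

namespace Literature.NumberTheory.Automorphic

variable {K : Type} [Field K] [NumberField K]

/-! ### 1. The rows of `k ∈ K_∞` are unit vectors -/

section Rows

/-- For `k ∈ K_∞ = U(2, K_∞)`: `Σ_j k_{ij} star k_{ij} = 1` (the rows are unit vectors: `k star k = 1`). [folklore] -/
theorem sum_lastRow_mul_star_eq_one_of_mem_Kinf {k : GL (Fin 2) (mixedSpace K)} (hk : k ∈ Kinf 2 K) (i : Fin 2) :
    ∑ j, (k : Matrix (Fin 2) (Fin 2) (mixedSpace K)) i j * star ((k : Matrix (Fin 2) (Fin 2) (mixedSpace K)) i j) = 1 := by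
  rw [Kinf_eq_unitarySubgroupGL] at hk
  have h := (mem_unitarySubgroupGL_iff _).1 (star_mem_unitarySubgroupGL hk)
  rw [Units.coe_star, star_star] at h
  have hii := congrFun (congrFun h i) i
  rw [Matrix.mul_apply, Matrix.one_apply_eq] at hii
  simpa only [Matrix.star_apply] using hii

/-- For `k ∈ K_∞` and a real place `w`: `Σ_j (k_{ij})_w² = 1`. [folklore] -/
theorem sum_sq_lastRow_eq_one_of_mem_Kinf {k : GL (Fin 2) (mixedSpace K)} (hk : k ∈ Kinf 2 K) (i : Fin 2)
    (w : {w : InfinitePlace K // IsReal w}) :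
    ∑ j, (((k : Matrix (Fin 2) (Fin 2) (mixedSpace K)) i j).1 w) ^ 2 = 1 := by
  have h := congrFun (congrArg Prod.fst (sum_lastRow_mul_star_eq_one_of_mem_Kinf hk i)) w
  simp only [Prod.fst_sum, Finset.sum_apply, Prod.fst_mul, Pi.mul_apply, Prod.fst_star, star_trivial,
    Prod.fst_one, Pi.one_apply] at h
  simpa only [sq] using h

/-- For `k ∈ K_∞` and a complex place `w`: `Σ_j |(k_{ij})_w|² = 1`. [folklore] -/
theorem sum_norm_sq_lastRow_eq_one_of_mem_Kinf {k : GL (Fin 2) (mixedSpace K)} (hk : k ∈ Kinf 2 K) (i : Fin 2)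
    (w : {w : InfinitePlace K // IsComplex w}) :
    ∑ j, ‖((k : Matrix (Fin 2) (Fin 2) (mixedSpace K)) i j).2 w‖ ^ 2 = 1 := by
  have h := congrFun (congrArg Prod.snd (sum_lastRow_mul_star_eq_one_of_mem_Kinf hk i)) w
  simp only [Prod.snd_sum, Finset.sum_apply, Prod.snd_mul, Pi.mul_apply, Prod.snd_star, Pi.star_apply, Complex.star_def,
    Prod.snd_one, Pi.one_apply, Complex.mul_conj'] at h
  exact_mod_cast h

end Rows

/-! ### 2. The standard Gaussian on `K_∞²` as `exp(-‖T x‖²)` -/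

section Gaussian

variable (K)

/-- `dim_ℝ (K_∞)² = 2 (r₁ + 2 r₂) = #(Fin 2 × index K)`. [folklore] -/
theorem finrank_fin_two_mixedSpace_eq_card :
    Module.finrank ℝ (Fin 2 → mixedSpace K) = Fintype.card (Fin 2 × index K) := by
  rw [Module.finrank_pi_fintype ℝ, Fin.sum_univ_two, Fintype.card_prod, Fintype.card_fin,
    ← finrank_fin_one_mixedSpace_eq_card_index K, Module.finrank_pi_fintype ℝ, Fin.sum_univ_one]
  ring

/-- **The standard Gaussian of `K_∞²` is `exp(-‖T x‖²)`** for a linear isomorphism `T` onto Euclidean space: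
there is `T : (K_∞)² ≃L[ℝ] ℝ^{dim}` with `‖T x‖² = π Σ_j (Σ_{w real} x_{j,w}² + Σ_{w complex} |x_{j,w}|²)`.
[cite: HumphriesJo2024, (5.1)] -/
theorem exists_clEquiv_norm_sq_eq_standard :
    ∃ T : (Fin 2 → mixedSpace K) ≃L[ℝ] EuclideanSpace ℝ (Fin (Module.finrank ℝ (Fin 2 → mixedSpace K))),
      ∀ x : Fin 2 → mixedSpace K, ‖T x‖ ^ 2 =
        Real.pi * ∑ j, ((∑ w, ((x j).1 w) ^ 2) + ∑ w, ‖(x j).2 w‖ ^ 2) := by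
  let V := Fin 2 → mixedSpace K
  let ι := Fin 2 × index K
  let pr : Fin 2 → (V →L[ℝ] mixedSpace K) := fun j => ContinuousLinearMap.proj (R := ℝ) (φ := fun _ : Fin 2 => mixedSpace K) j
  let coord : ι → (V →L[ℝ] ℝ) := fun p => Sum.elim
    (fun w => (ContinuousLinearMap.proj (R := ℝ) (φ := fun _ : {w : InfinitePlace K // IsReal w} => ℝ) w).comp
      ((ContinuousLinearMap.fst ℝ _ _).comp (pr p.1)))
    (fun q => ((if q.2 = 0 then Complex.reCLM else Complex.imCLM).comp
      ((ContinuousLinearMap.proj (R := ℝ) (φ := fun _ : {w : InfinitePlace K // IsComplex w} => ℂ) q.1).comp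
        ((ContinuousLinearMap.snd ℝ _ _).comp (pr p.1))))) p.2
  have hinl : ∀ (j : Fin 2) (w) (x : V), coord (j, Sum.inl w) x = (x j).1 w := fun j w x => rfl
  have hinr0 : ∀ (j : Fin 2) (w) (x : V), coord (j, Sum.inr (w, 0)) x = ((x j).2 w).re := fun j w x => rfl
  have hinr1 : ∀ (j : Fin 2) (w) (x : V), coord (j, Sum.inr (w, 1)) x = ((x j).2 w).im := fun j w x => rfl
  let f : V →ₗ[ℝ] EuclideanSpace ℝ ι :=
    (WithLp.linearEquiv 2 ℝ (ι → ℝ)).symm.toLinearMap ∘ₗ LinearMap.pi (fun i => Real.sqrt Real.pi • (coord i).toLinearMap)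
  have hf : ∀ (x : V) (i : ι), f x i = Real.sqrt Real.pi * coord i x := fun x i => rfl
  have hfinj : Function.Injective f := by
    intro x y hxy
    have h : ∀ i, coord i x = coord i y := fun i => by
      have h1 := congrArg (fun v : EuclideanSpace ℝ ι => v i) hxy
      simp only [hf] at h1
      exact mul_left_cancel₀ (Real.sqrt_ne_zero'.mpr Real.pi_pos) h1
    funext j
    refine Prod.ext (funext fun w => ?_) (funext fun w => Complex.ext ?_ ?_)
    · simpa only [hinl] using h (j, Sum.inl w)
    · simpa only [hinr0] using h (j, Sum.inr (w, 0))
    · simpa only [hinr1] using h (j, Sum.inr (w, 1))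
  have hdim : Module.finrank ℝ V = Module.finrank ℝ (EuclideanSpace ℝ ι) := by
    rw [finrank_euclideanSpace]
    exact finrank_fin_two_mixedSpace_eq_card K
  let fe : V ≃ₗ[ℝ] EuclideanSpace ℝ ι := f.linearEquivOfInjective hfinj hdim
  have hfe : ∀ x, fe x = f x := fun x => rfl
  have hcard : Fintype.card ι = Module.finrank ℝ V := (finrank_fin_two_mixedSpace_eq_card K).symm
  let eFin : ι ≃ Fin (Module.finrank ℝ V) := Fintype.equivFinOfCardEq hcard
  let T : V ≃L[ℝ] EuclideanSpace ℝ (Fin (Module.finrank ℝ V)) :=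
    fe.toContinuousLinearEquiv.trans (LinearIsometryEquiv.piLpCongrLeft 2 ℝ ℝ eFin).toContinuousLinearEquiv
  refine ⟨T, fun x => ?_⟩
  have h1 : ‖T x‖ = ‖f x‖ := by
    change ‖(LinearIsometryEquiv.piLpCongrLeft 2 ℝ ℝ eFin) (fe.toContinuousLinearEquiv x)‖ = _
    rw [LinearIsometryEquiv.norm_map]
    rfl
  rw [h1, EuclideanSpace.real_norm_sq_eq, Fintype.sum_prod_type]
  simp only [Fintype.sum_sum_type, Fintype.sum_prod_type]
  have key : ∀ (j : Fin 2) (w : {w : InfinitePlace K // IsComplex w}),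
      (Real.sqrt Real.pi * ((x j).2 w).re) ^ 2 + (Real.sqrt Real.pi * ((x j).2 w).im) ^ 2 =
        Real.pi * ‖(x j).2 w‖ ^ 2 := fun j w => by
    rw [mul_pow, mul_pow, Real.sq_sqrt Real.pi_pos.le, Complex.sq_norm, Complex.normSq_apply]
    ring
  have key' : ∀ (j : Fin 2) (w : {w : InfinitePlace K // IsReal w}),
      (Real.sqrt Real.pi * (x j).1 w) ^ 2 = Real.pi * ((x j).1 w) ^ 2 := fun j w => by
    rw [mul_pow, Real.sq_sqrt Real.pi_pos.le]
  simp only [hf, hinl, Fin.sum_univ_two, hinr0, hinr1, key, key', ← Finset.mul_sum, mul_add]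

end Gaussian

/-! ### 3. The factorising test functions -/

section TestFunction

variable (K)

/-- **Humphries–Jo's test functions factor along the last row.** Let `P` be a function on `K_∞²` which is
a complex polynomial in the real coordinates and is homogeneous for the diagonal action of `K_∞ˣ`,
`P(c · x) = χ(c) P(x)`. Then `Φ_∞(z) = P(x) exp(-π Σ_j (Σ_{w real} x_{j,w}² + Σ_{w complex} |x_{j,w}|²))`
(`x` the image of `z` in `K_∞²`) is polynomial-times-Gaussian (`IsArchPolyGaussian 2 K Φ_∞`) and, for every
`y ∈ (K_∞ˣ)²` and `k ∈ K_∞`,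
`Φ_∞(e₂ diag(y) k) = χ(y₂) exp(-π (Σ_{w real} y_{2,w}² + Σ_{w complex} |y_{2,w}|²)) · P(e₂ k)`:
the last row of `diag(y) k` is `y₂ · e₂ k`, `P` is homogeneous and the standard Gaussian is
`K_∞`-invariant (the rows of `k` are unit vectors). Humphries–Jo (2024), (5.1): "`Φ_ur(xk) = Φ_ur(x)` for all
`k ∈ K_n`", and the proof of Prop. 5.2: "`Φ(z e_n k⁻¹) = χ_π χ_σ(z/‖z‖) ‖z‖^{c(π)+c(σ)} e^{-d_F π ‖z‖²} Σ …`".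
[cite: HumphriesJo2024, §5, (5.1), (5.3) and proof of Prop. 5.2 (pp. 151–152)] -/
theorem exists_isArchPolyGaussian_factor (P : (Fin 2 → mixedSpace K) → ℂ) (χ : (mixedSpace K)ˣ → ℂ)
    (hPpoly : ∃ (N : ℕ) (L : Fin N → ((Fin 2 → mixedSpace K) →L[ℝ] ℝ)) (q : MvPolynomial (Fin N) ℂ),
      ∀ x, P x = MvPolynomial.eval (fun i => ((L i x : ℝ) : ℂ)) q)
    (hPhom : ∀ (c : (mixedSpace K)ˣ) (x : Fin 2 → mixedSpace K), P (fun j => (c : mixedSpace K) * x j) = χ c * P x) :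
    ∃ Φ : (Fin 2 → InfiniteAdeleRing K) → ℂ, IsArchPolyGaussian 2 K Φ ∧
      (∀ z : Fin 2 → InfiniteAdeleRing K,
        Φ z = P (fun j => InfiniteAdeleRing.ringEquiv_mixedSpace K (z j)) *
          (Real.exp (-(Real.pi * ∑ j, ((∑ w, ((InfiniteAdeleRing.ringEquiv_mixedSpace K (z j)).1 w) ^ 2) +
            ∑ w, ‖(InfiniteAdeleRing.ringEquiv_mixedSpace K (z j)).2 w‖ ^ 2))) : ℂ)) ∧
      ∀ (y : Fin 2 → (mixedSpace K)ˣ) (k : GL (Fin 2) (mixedSpace K)), k ∈ Kinf 2 K →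
        Φ (archLastRow 2 K (glDiagonal 2 (mixedSpace K) y * k)) =
          (χ (y (Fin.last 1)) *
            (Real.exp (-(Real.pi * ((∑ w, (((y (Fin.last 1) : (mixedSpace K)ˣ) : mixedSpace K).1 w) ^ 2) +
              ∑ w, ‖((y (Fin.last 1) : (mixedSpace K)ˣ) : mixedSpace K).2 w‖ ^ 2))) : ℂ)) *
          P (fun j => (k : Matrix (Fin 2) (Fin 2) (mixedSpace K)) (Fin.last 1) j) := by
  obtain ⟨N, L, q, hP⟩ := hPpoly
  obtain ⟨T, hT⟩ := exists_clEquiv_norm_sq_eq_standard K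
  let xz : (Fin 2 → InfiniteAdeleRing K) → (Fin 2 → mixedSpace K) := fun z j => InfiniteAdeleRing.ringEquiv_mixedSpace K (z j)
  refine ⟨fun z => MvPolynomial.eval (fun i => ((L i (xz z) : ℝ) : ℂ)) q * ((Real.exp (-‖T (xz z)‖ ^ 2) : ℝ) : ℂ),
    ⟨N, L, q, T, fun z => rfl⟩, fun z => ?_, fun y k hk => ?_⟩
  · -- the displayed formula
    change MvPolynomial.eval (fun i => ((L i (xz z) : ℝ) : ℂ)) q * ((Real.exp (-‖T (xz z)‖ ^ 2) : ℝ) : ℂ) = _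
    rw [← hP, hT]
  · -- the factorisation along the last row
    set c : (mixedSpace K)ˣ := y (Fin.last 1) with hc
    have hrow : xz (archLastRow 2 K (glDiagonal 2 (mixedSpace K) y * k)) =
        fun j => (c : mixedSpace K) * (k : Matrix (Fin 2) (Fin 2) (mixedSpace K)) (Fin.last 1) j := by
      funext j
      simp only [xz]
      rw [archLastRow_glDiagonal_mul (n := 1)]
      simp only [RingEquiv.apply_symm_apply]
      rfl
    change MvPolynomial.eval (fun i => ((L i (xz (archLastRow 2 K (glDiagonal 2 (mixedSpace K) y * k))) : ℝ) : ℂ)) q *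
        ((Real.exp (-‖T (xz (archLastRow 2 K (glDiagonal 2 (mixedSpace K) y * k)))‖ ^ 2) : ℝ) : ℂ) = _
    rw [← hP, hrow, hPhom, hT]
    -- the Gaussian is `K_∞`-invariant: the rows of `k` are unit vectors
    have hsum : ∑ j, ((∑ w, (((c : mixedSpace K) * (k : Matrix (Fin 2) (Fin 2) (mixedSpace K)) (Fin.last 1) j).1 w) ^ 2) +
          ∑ w, ‖((c : mixedSpace K) * (k : Matrix (Fin 2) (Fin 2) (mixedSpace K)) (Fin.last 1) j).2 w‖ ^ 2) =
        (∑ w, (((c : (mixedSpace K)ˣ) : mixedSpace K).1 w) ^ 2) + ∑ w, ‖((c : (mixedSpace K)ˣ) : mixedSpace K).2 w‖ ^ 2 := by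
      simp only [Prod.fst_mul, Prod.snd_mul, Pi.mul_apply, mul_pow, norm_mul]
      rw [Finset.sum_add_distrib]
      congr 1
      · rw [Finset.sum_comm]
        refine Finset.sum_congr rfl fun w _ => ?_
        rw [← Finset.mul_sum, sum_sq_lastRow_eq_one_of_mem_Kinf hk (Fin.last 1) w, mul_one]
      · rw [Finset.sum_comm]
        refine Finset.sum_congr rfl fun w _ => ?_
        rw [← Finset.mul_sum, sum_norm_sq_lastRow_eq_one_of_mem_Kinf hk (Fin.last 1) w, mul_one]
    rw [hsum]
    ring

end TestFunction

end Literature.NumberTheory.Automorphic
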